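import Literature.MathematicalPhysics.QuantumLattice.HubbardRingDecaySharp
import Literature.MathematicalPhysics.QuantumLattice.HubbardSignGaugeBoundSharp
import HarnessLib

/-!
# Koma–Tasaki decay in one dimension, magnetic case: exponential clustering of the transverse
# spin correlation on the Hubbard ring, explicit constants

Trunk T-QLATTICE (family `hubbard`; consumer: the cell file
`Summits/HubbardSuperconductivity/HubbardLadder/Bounds/RingSpinExponentialClustering.lean`;
companions: `HubbardRingDecaySharp.lean` (the `n`-fermion / superconducting case on the ring,
which supplies the clamped-cone test function `ringProfile` and its energy bound
`ringProfile_energy_le`) and `HubbardSignGaugeBoundSharp.lean` (the printed a priori bound for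
the spin-dependent sign gauge, `norm_thermalCorr_siteSpinPlus_le_sharp`, every dimension)).

Koma–Tasaki, PRL 68 (1992) 3248, Theorem, eq. (4) and the last clause: in one dimension
`|⟨S¹_x S¹_y + S²_x S²_y⟩| ≤ exp[-γ f(β)|x-y|]`, `f(β) ≈ 1/β` at low temperature; the constants
are not printed. This file proves the clause for the transverse correlation `⟨S⁺_x S⁻_y⟩_{β,L}`
of the grand-canonical Hubbard model `H(t,U) - μN` on the ring `ℤ/Lℤ` (`hubbardTorusWith 1 L t U μ`)
with EXPLICIT constants (sharper than, and not superseding, the explicit ones the tree already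
had — see "Relation to what the tree already proves" below), uniformly in `L`, for all real
`t, U, μ` and all `β ≥ 0`:

* `norm_thermalCorr_siteSpinPlus_ring_le_exp` — for every `q ≥ 0`,
  `|⟨S⁺_x S⁻_y⟩_{β,L}| ≤ e^{4q} exp(-[2q - 4β|t|(cosh q - 1)] dist(x,y))` (the spin observable
  has gauge charge `2` under the spin rotation about the `z`-axis, like a pair under the charge
  gauge; test function = the clamped cone of the superconducting case);
* `norm_thermalCorr_siteSpinPlus_ring_le_exp_lowT` — if `1 ≤ 4β|t|` (`T ≤ 4|t|`):
  `≤ e^{1/(β|t|)} exp(-dist(x,y)/(4β|t|))`, i.e. the transverse spin correlation length obeys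
  `ξ_spin(T) ≤ 4β|t| = 4|t|/T`;
* `norm_thermalCorr_siteSpinPlus_ring_le_exp_highT` — if `4β|t| ≤ 1`: `≤ e^4 exp(-dist(x,y))`.

Sources: T. Koma, H. Tasaki, PRL 68 (1992) 3248 (= arXiv:cond-mat/9709068), Theorem eq. (4),
the one-dimensional clause, eqs. (5)–(13), note 9 and the last paragraph of the proof;
O. A. McBryan, T. Spencer, Commun. Math. Phys. 53 (1977) 299.

## Relation to what the tree already proves

The QUALITATIVE clause is already a theorem of the tree: the `d = 1` conjunct of
`koma_tasaki_magnetic_holds` (`HubbardHubbardModelKomaTasakiProofs`) gives, for all `t, U, μ`,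
`β > 0`, uniformly in `L`, `|⟨S⁺_x S⁻_y⟩_{β,L}| ≤ 1 · exp(-dist(x,y)/(16β|t| + 1))` — prefactor
`1`, rate `1/(16β|t|+1)` (linear two-arc profile `exists_testFunction_one`, charge `≤ 1`,
operator-norm a priori bound `norm_thermalCorr_siteSpinPlus_le`). Relative to it this file adds
only the RATES: the free-charge family with the printed hopping norm, whose low-temperature rate
`1/(4β|t|)` is `≥ 4 · 1/(16β|t|+1)` (four times the tree's) at the price of the prefactor
`e^{1/(β|t|)} ≤ e⁴` instead of `1` — the new bound is the smaller one at every distance `≥ 6`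
and every `T ≤ 4|t|` (exponents `1/b - r/(4b) ≤ -r/(16b+1) ⟺ 4(16b+1) ≤ r(12b+1)`,
`b = β|t| ≥ 1/4`), the tree's at distances `≤ 5`; and the high-temperature rate `1` versus
`1/(16β|t|+1) ∈ [1/5, 1)`. Nothing here supersedes `koma_tasaki_magnetic_holds`; both hold.

## Mathlib / tree search

Tree: `koma_tasaki_magnetic_holds`, `le_exp_of_forall_testFunction_one`
(`HubbardHubbardModelKomaTasakiProofs`), `exists_testFunction_one` (`LatticeToriProofs`) — the
prior one-dimensional result, see above. As for the companions: no Fock space in Mathlib; the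
tree's matrix model is reused (`siteSpinPlus`, `hubbardTorusWith`, `thermalCorr`, `torusDist`,
`ringProfile`).

## Design notes

The magnetic a priori bound `norm_thermalCorr_siteSpinPlus_le_sharp` takes an arbitrary real
`ψ` on the torus with eigenvalue factor `e^{-2(ψ_x - ψ_y)}` and the printed energy
`β|t| Σ_u Σ_{u'} [u∼u'](cosh(ψ_u - ψ_{u'}) - 1)`; with `ψ = ringProfile x (r-1) q`
(`ψ_x = -q`, `ψ_y = -q(r-1)`, `r = dist(x,y) ≥ 2`) and `ringProfile_energy_le` this is
`e^{-2q(r-2)} e^{4β|t|(r-1)(cosh q - 1)}`; `r ≤ 1` is covered by `ψ = 0`. No flatness is needed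
(site-local observable), but the same profile keeps the constants of the superconducting case.
-/

noncomputable section

namespace Literature.MathematicalPhysics.QuantumLattice

open Matrix Finset NormedSpace Literature.Probability.LatticeModels
open scoped Matrix.Norms.L2Operator ComplexOrder

section RingSpin

variable {L : ℕ} [NeZero L]

omit [NeZero L] in
/-- The clamp at the centre is `1` (`R ≥ 1`). [folklore] -/
private theorem ringClamp_self {x : TorusSite 1 L} {R : ℕ} (hR : 1 ≤ R) : ringClamp x R x = 1 := by
  unfold ringClamp
  rw [torusDist_self, max_eq_right (Nat.zero_le 1), min_eq_left hR]

omit [NeZero L] in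
/-- Far from the centre (`dist(u,x) ≥ R`) the clamp is `R`. [folklore] -/
private theorem ringClamp_far {x u : TorusSite 1 L} {R : ℕ} (hu : R ≤ torusDist u x) :
    ringClamp x R u = R := by
  unfold ringClamp
  exact min_eq_right (le_trans hu (le_max_left _ _))

/-- **A priori: the transverse spin correlation is at most `1`** (`ψ = 0` in the printed bound).
[cite: KomaTasakiPRL1992, eq. (12), magnetic case] -/
theorem norm_thermalCorr_siteSpinPlus_le_one' {d : ℕ} (L : ℕ) [NeZero L] (t U μ β : ℝ)
    (hβ : 0 ≤ β) (x y : TorusSite d L) :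
    ‖(hubbardTorusWith d L t U μ).thermalCorr β (siteSpinPlus x) (siteSpinPlus y)ᴴ‖ ≤ 1 := by
  have h := norm_thermalCorr_siteSpinPlus_le_sharp t U μ β hβ (fun _ => (0 : ℝ)) x y
  simpa using h

/-- **Sharp one-dimensional Koma–Tasaki bound, magnetic case** (Theorem eq. (4), one-dimensional
clause; printed hopping norm): on the Hubbard ring `ℤ/Lℤ` with Hamiltonian `H(t,U) - μN`, for all
real `t, U, μ`, `β ≥ 0`, every `q ≥ 0` and all sites `x, y`, uniformly in `L`:
`|⟨S⁺_x S⁻_y⟩_{β,L}| ≤ e^{4q} exp(-[2q - 4β|t|(cosh q - 1)] dist(x,y))`.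
[cite: KomaTasakiPRL1992, Theorem eq. (4) (one-dimensional clause), eqs. (5)–(13)] [cite: McBryanSpencer1977] -/
theorem norm_thermalCorr_siteSpinPlus_ring_le_exp (L : ℕ) [NeZero L] (t U μ β q : ℝ)
    (hβ : 0 ≤ β) (hq : 0 ≤ q) (x y : TorusSite 1 L) :
    ‖(hubbardTorusWith 1 L t U μ).thermalCorr β (siteSpinPlus x) (siteSpinPlus y)ᴴ‖ ≤
      Real.exp (4 * q) *
        Real.exp (-((2 * q - 4 * (β * |t|) * (Real.cosh q - 1)) * (torusDist x y : ℝ))) := by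
  have hC : 0 ≤ Real.cosh q - 1 := sub_nonneg.2 (Real.one_le_cosh q)
  have hb : 0 ≤ β * |t| := mul_nonneg hβ (abs_nonneg t)
  rw [← Real.exp_add]
  rcases le_or_gt (torusDist x y) 1 with hr1 | hr2
  · refine (norm_thermalCorr_siteSpinPlus_le_one' L t U μ β hβ x y).trans (Real.one_le_exp ?_)
    have hr1' : (torusDist x y : ℝ) ≤ 1 := by exact_mod_cast hr1
    have hr0 : (0 : ℝ) ≤ torusDist x y := Nat.cast_nonneg _
    nlinarith [mul_nonneg (mul_nonneg hb hC) hr0, mul_nonneg hq (sub_nonneg.2 hr1')]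
  · set r : ℕ := torusDist x y with hr
    have hR1 : 1 ≤ r - 1 := by omega
    set ψ : TorusSite 1 L → ℝ := ringProfile x (r - 1) q with hψ
    have key := norm_thermalCorr_siteSpinPlus_le_sharp (d := 1) t U μ β hβ ψ x y
    rw [← Real.exp_add] at key
    have hyfar : r - 1 ≤ torusDist y x := by rw [torusDist_comm' y x]; omega
    have hψx : ψ x = -q := by
      simp only [hψ, ringProfile, ringClamp_self hR1, Nat.cast_one, mul_one]
    have hψy : ψ y = -(q * ((r - 1 : ℕ) : ℝ)) := by
      simp only [hψ, ringProfile, ringClamp_far hyfar]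
    have hE := ringProfile_energy_le x (r - 1) hq
    have hE' : β * (|t| * ∑ a : TorusSite 1 L, ∑ b : TorusSite 1 L,
        (if (torusGraph 1 L).Adj a b then (Real.cosh (ψ a - ψ b) - 1) else 0)) ≤
        β * (|t| * (4 * ((r - 1 : ℕ) : ℝ) * (Real.cosh q - 1))) :=
      mul_le_mul_of_nonneg_left (mul_le_mul_of_nonneg_left hE (abs_nonneg t)) hβ
    have hcast : ((r - 1 : ℕ) : ℝ) = (r : ℝ) - 1 := by
      rw [Nat.cast_sub (by omega : 1 ≤ r), Nat.cast_one]
    refine key.trans (Real.exp_le_exp.2 ?_)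
    rw [hψx, hψy, hcast]
    rw [hcast] at hE'
    nlinarith [mul_nonneg hb hC]

/-- **Low temperatures: transverse spin correlation length `≤ 4|t|/T`**: if `1 ≤ 4β|t|` then,
with `q = 1/(4β|t|)`, `|⟨S⁺_x S⁻_y⟩_{β,L}| ≤ e^{1/(β|t|)} exp(-dist(x,y)/(4β|t|))`, uniformly in
`L`, all real `U`, `μ`. [cite: KomaTasakiPRL1992, Theorem eq. (4) (one-dimensional clause) and p. 3249] -/
theorem norm_thermalCorr_siteSpinPlus_ring_le_exp_lowT (L : ℕ) [NeZero L] (t U μ β : ℝ)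
    (hβ : 0 ≤ β) (hT : 1 ≤ 4 * (β * |t|)) (x y : TorusSite 1 L) :
    ‖(hubbardTorusWith 1 L t U μ).thermalCorr β (siteSpinPlus x) (siteSpinPlus y)ᴴ‖ ≤
      Real.exp (1 / (β * |t|)) * Real.exp (-(1 / (4 * (β * |t|)) * (torusDist x y : ℝ))) := by
  set b : ℝ := β * |t| with hb
  have hbpos : 0 < b := by linarith
  set q : ℝ := 1 / (4 * b) with hq
  have hq0 : 0 ≤ q := by positivity
  have hq1 : q ≤ 1 := by
    rw [hq, div_le_one (by positivity)]
    linarith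
  have h := norm_thermalCorr_siteSpinPlus_ring_le_exp L t U μ β q hβ hq0 x y
  have hcosh : Real.cosh q - 1 ≤ q ^ 2 :=
    cosh_sub_one_le_sq (s := q) (by rw [abs_of_nonneg hq0]; exact hq1)
  have h4q : 4 * q = 1 / b := by rw [hq]; field_simp
  have hm : 1 / (4 * b) ≤ 2 * q - 4 * b * (Real.cosh q - 1) := by
    have h4b : 4 * b * (Real.cosh q - 1) ≤ 4 * b * q ^ 2 :=
      mul_le_mul_of_nonneg_left hcosh (by positivity)
    have hval : 2 * q - 4 * b * q ^ 2 = 1 / (4 * b) := by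
      rw [hq]; field_simp; ring
    linarith
  refine h.trans ?_
  rw [h4q]
  refine mul_le_mul_of_nonneg_left (Real.exp_le_exp.2 ?_) (Real.exp_pos _).le
  have hr0 : (0 : ℝ) ≤ torusDist x y := Nat.cast_nonneg _
  nlinarith

/-- **High temperatures** (`4β|t| ≤ 1`): with `q = 1` and `cosh 1 - 1 ≤ 1`,
`|⟨S⁺_x S⁻_y⟩_{β,L}| ≤ e^4 exp(-dist(x,y))`, uniformly in `L`, all real `U`, `μ`.
[cite: KomaTasakiPRL1992, Theorem eq. (4) (one-dimensional clause) and p. 3249] -/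
theorem norm_thermalCorr_siteSpinPlus_ring_le_exp_highT (L : ℕ) [NeZero L] (t U μ β : ℝ)
    (hβ : 0 ≤ β) (hT : 4 * (β * |t|) ≤ 1) (x y : TorusSite 1 L) :
    ‖(hubbardTorusWith 1 L t U μ).thermalCorr β (siteSpinPlus x) (siteSpinPlus y)ᴴ‖ ≤
      Real.exp 4 * Real.exp (-(torusDist x y : ℝ)) := by
  have h := norm_thermalCorr_siteSpinPlus_ring_le_exp L t U μ β 1 hβ zero_le_one x y
  have hcosh : Real.cosh 1 - 1 ≤ 1 := by
    have := cosh_sub_one_le_sq (s := (1 : ℝ)) (by norm_num)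
    simpa using this
  have hb : 0 ≤ β * |t| := mul_nonneg hβ (abs_nonneg t)
  rw [mul_one] at h
  refine h.trans (mul_le_mul_of_nonneg_left (Real.exp_le_exp.2 ?_) (Real.exp_pos _).le)
  have hr0 : (0 : ℝ) ≤ torusDist x y := Nat.cast_nonneg _
  have hm : (1 : ℝ) ≤ 2 * 1 - 4 * (β * |t|) * (Real.cosh 1 - 1) := by
    nlinarith [mul_le_mul_of_nonneg_left hcosh (by positivity : (0 : ℝ) ≤ 4 * (β * |t|))]
  nlinarith

end RingSpin

end Literature.MathematicalPhysics.QuantumLattice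

end
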